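import Summits.CriticalPhenomena.Ising3DConformalLimit.Theorems.EnergyNotSigmaSquaredRungOneAdjacentMergingDefs
import Literature.Probability.LatticeModels.ImprovedTreeDiagramBoundProofs
import Literature.Probability.LatticeModels.DirInvCorrLength
import Literature.Probability.LatticeModels.TwoPointLogConvex
import Literature.Probability.LatticeModels.CriticalTwoPointBounds
import Literature.Probability.LatticeModels.TwoPointSupNormMonotone
import Literature.Probability.LatticeModels.IsingBubbleDivergenceProofs
import HarnessLib

/-!
# Stub `stub_harvestInputs` of the line `dominant-shell-concentration` for the crux `RungOneAdjacentMerging`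
(item stmt-CriticalPhenomena-11262, route `EnergyNotSigmaSquared`; target file
`Summits/CriticalPhenomena/Ising3DConformalLimit/Theorems/EnergyNotSigmaSquaredRungOneAdjacentMergingHarvestInputs.lean`)

What is proved: `HarvestInputs`, i.e. the nine fields of `HarvestData a B` (objects file
`EnergyNotSigmaSquaredRungOneAdjacentMergingDefs`) for the critical axis profile
`a j = g(2^j) = ⟨σ₀σ_{2^j e₁}⟩⁺_{β_c(3)}` (`axisG`) and the dyadic truncated bubble
`B k = B(2^k) = Σ_{‖z‖_∞ ≤ 2^k} ⟨σ₀σ_z⟩²_{β_c(3)}` (`Bub`) of the nearest-neighbour Ising model on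
`ℤ³` at `β_c`.  Every input is a theorem of the tree:

* `a_pos`: `⟨σ₀σ_x⟩⁺_β > 0` for `β > 0` (`twoPointPlus_pos`, `criticalBeta_pos_holds`);
* `a_anti`: Messager–Miracle-Solé monotonicity along the axis (`messager_miracleSole_holds`,
  iterated in `twoPointPlus_add_single_le`);
* `a_tendsto`: the infrared upper bound `⟨σ₀σ_x⟩_{β_c} ≤ C‖x‖^{-1}` (`criticalTwoPoint_bounds_holds`,
  Duminil-Copin 2019 Thm 4.8);
* `a_logConvex`: axis log-convexity `g(n)² ≤ g(n-1) g(n+1)` (Aizenman–Duminil-Copin 2021, Prop. 5.3 /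
  proof of Prop. 5.9; tree `twoPointPlus_axisPair_sq_le` at `m*(β_c(3)) = 0`,
  `spontaneousMagnetization_criticalBeta_eq_zero_holds`), and the elementary dyadic consequence
  `g(2m)³ ≤ g(m)² g(4m)` for positive log-convex sequences (`harvest_pow_three_le_of_logConvex`: the ratios
  `g(n+1)/g(n)` are non-decreasing, telescope over `[m,2m)` and `[2m,4m)`);
* `B_pos`, `B_mono`: `B(L) ≥ G(0)² = 1`, monotonicity of the truncated bubble
  (`sq_apply_zero_le_bubbleDiagram`, `twoPointPlus_zero`, `bubbleDiagram_mono`);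
* `B_tendsto`: divergence of the critical bubble `B(β_c(3)) = ∞` (Duminil-Copin–Panis 2025, Thm 1.8;
  tree `DuminilCopinPanis2025_bubbleDiagram_eq_top_holds`, stated for `⟨·⟩^free`, `= ⟨·⟩⁺` at `β_c`
  by `twoPointPlus_criticalBeta_eq_twoPointFree_holds`): every finite partial sum sits inside some
  `B(2^k)`;
* `shell_lower` / `shell_upper`: on the dyadic shell `2^{k-1} < ‖z‖_∞ ≤ 2^k` (between `7·8^k` and
  `19·8^k` sites, `card_box`) one has `g(2^{k+2}) ≤ G(z) ≤ g(2^{k-1})` by the Messager–Miracle-Solé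
  comparison in the sup norm (Aizenman–Duminil-Copin 2021, (5.3); tree
  `twoPointPlus_le_of_mul_supNorm_le`, `twoPointPlus_le_axis_of_mem_sphere` + axis monotonicity),
  and `B(2^k) - B(2^{k-1})` is the shell sum of `G²` (`bubbleDiagram_sub_nat`).

Design: all statements are at `d = 3`, `β = β_c(3)`; the shell lemmas are proved for the shell
`Λ_{2^{k+1}} ∖ Λ_{2^k}` (`k : ℕ`) and re-indexed in the stub.  No new definitions.
-/

noncomputable section

open MeasureTheory Filter Finset
open scoped BigOperators ENNReal symmDiff
open Literature.Probability.LatticeModels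

namespace Summit.CriticalPhenomena.Ising3DConformalLimit.RungOneAdjacentMergingDominantShell

/-! Objects of the line: `Theorems/EnergyNotSigmaSquaredRungOneAdjacentMergingDefs.lean` (imported). -/

/-! ### The critical axis profile `g(m) = ⟨σ₀σ_{m e₁}⟩⁺_{β_c(3)}` -/

/-- `β_c(3) > 0` (Peierls; tree `criticalBeta_pos_holds`). [folklore] -/
private theorem harvest_criticalBeta_three_pos : 0 < criticalBeta 3 :=
  criticalBeta_pos_holds (d := 3) (by norm_num)

/-- `g(m) > 0` (Griffiths; tree `twoPointPlus_pos`). [folklore] -/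
private theorem harvest_axisG_pos (m : ℕ) : 0 < axisG m :=
  twoPointPlus_pos harvest_criticalBeta_three_pos _

/-- `G(z) > 0` (Griffiths; tree `twoPointPlus_pos`). [folklore] -/
private theorem harvest_Gc_pos (z : Site 3) : 0 < Gc z :=
  twoPointPlus_pos harvest_criticalBeta_three_pos z

/-- `G = ⟨·⟩^free` at `β_c(3)` (Aizenman–Duminil-Copin–Sidoravicius 2015; tree
`twoPointPlus_criticalBeta_eq_twoPointFree_holds`). [folklore] -/
private theorem harvest_Gc_eq_twoPointFree (z : Site 3) : Gc z = twoPointFree 3 (criticalBeta 3) z :=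
  twoPointPlus_criticalBeta_eq_twoPointFree_holds (d := 3) (by norm_num) z

/-- Axis monotonicity `m ≤ n ⇒ g(n) ≤ g(m)` (Messager–Miracle-Solé iterated along `e₁`, tree
`twoPointPlus_add_single_le`). [cite: MessagerMiracleSoleJSP1977, main theorem (monotonicity of ⟨σ₀σ_x⟩ under reflections)] -/
private theorem harvest_axisG_le_of_le {m n : ℕ} (h : m ≤ n) : axisG n ≤ axisG m := by
  have key := twoPointPlus_add_single_le (messager_miracleSole_holds (d := 3)) (criticalBeta_nonneg 3)
    (Pi.single 0 (m : ℤ)) 0 (by simp) (n - m)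
  rw [← Pi.single_add] at key
  have hmn : (m : ℤ) + ((n - m : ℕ) : ℤ) = (n : ℤ) := by push_cast [Nat.cast_sub h]; ring
  rw [hmn] at key
  exact key

/-- Axis log-convexity `g(n+1)² ≤ g(n) g(n+2)` (spectral representation / reflection positivity,
Aizenman–Duminil-Copin 2021, Prop. 5.3 as used in the proof of Prop. 5.9; tree
`twoPointPlus_axisPair_sq_le` with `x_⊥ = 0` at `m*(β_c(3)) = 0`). [cite: AizenmanDuminilCopinAnnals2021, arXiv:1912.07973 Prop. 5.3 (5.17) and §5.5 proof of Prop. 5.9 (p. 19)] -/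
private theorem harvest_axisG_succ_sq_le (n : ℕ) : axisG (n + 1) ^ 2 ≤ axisG n * axisG (n + 2) := by
  have hm : spontaneousMagnetization (2 + 1) (criticalBeta 3) = 0 :=
    spontaneousMagnetization_criticalBeta_eq_zero_holds (d := 3) (by norm_num)
  have key : (axisG (n + 1) + axisG (n + 1)) ^ 2 ≤
      (axisG n + axisG n) * (axisG (n + 2) + axisG (n + 2)) := by
    have h := twoPointPlus_axisPair_sq_le (d' := 2) (criticalBeta_nonneg 3) hm 0 0 rfl
      (n := n + 1) (by omega)
    rw [zero_add, zero_add, zero_add, Nat.add_sub_cancel] at h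
    exact h
  nlinarith [key]

/-- Dyadic consequence of log-convexity for a positive sequence: if `g(n+1)² ≤ g(n) g(n+2)` for all
`n`, then `g(2m)³ ≤ g(m)² g(4m)` (the ratios `ρ(n) = g(n+1)/g(n)` are non-decreasing, so
`g(2m)/g(m) = ∏_{[m,2m)} ρ ≤ ρ(2m)^m` and `g(4m)/g(2m) = ∏_{[2m,4m)} ρ ≥ ρ(2m)^{2m}`). [folklore] -/
private theorem harvest_pow_three_le_of_logConvex {g : ℕ → ℝ} (hpos : ∀ n, 0 < g n)
    (hlc : ∀ n, g (n + 1) ^ 2 ≤ g n * g (n + 2)) (m : ℕ) :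
    g (2 * m) ^ 3 ≤ g m ^ 2 * g (4 * m) := by
  obtain ⟨ρ, hρ⟩ : ∃ ρ : ℕ → ℝ, ∀ n, ρ n = g (n + 1) / g n := ⟨_, fun _ => rfl⟩
  have hρpos : ∀ n, 0 < ρ n := fun n => by rw [hρ]; exact div_pos (hpos _) (hpos _)
  have hρmono : Monotone ρ := by
    refine monotone_nat_of_le_succ fun n => ?_
    rw [hρ, hρ, div_le_div_iff₀ (hpos _) (hpos _)]
    have h := hlc n
    have e : n + 2 = n + 1 + 1 := rfl
    rw [e] at h
    nlinarith [h]
  -- telescoping `g(a+k) = g(a) ∏_{i<k} ρ(a+i)`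
  have htel : ∀ a k : ℕ, g (a + k) = g a * ∏ i ∈ Finset.range k, ρ (a + i) := by
    intro a k
    induction k with
    | zero => simp
    | succ k ih =>
        rw [Finset.prod_range_succ, ← mul_assoc, ← ih, hρ, ← add_assoc, mul_div_assoc',
          eq_div_iff (hpos _).ne', mul_comm]
  have hA : ∏ i ∈ Finset.range m, ρ (m + i) ≤ ρ (2 * m) ^ m := by
    calc ∏ i ∈ Finset.range m, ρ (m + i) ≤ ∏ _i ∈ Finset.range m, ρ (2 * m) :=
          Finset.prod_le_prod (fun i _ => (hρpos _).le) fun i hi =>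
            hρmono (by have := Finset.mem_range.1 hi; omega)
      _ = ρ (2 * m) ^ m := by rw [Finset.prod_const, Finset.card_range]
  have hB : ρ (2 * m) ^ (2 * m) ≤ ∏ i ∈ Finset.range (2 * m), ρ (2 * m + i) := by
    calc ρ (2 * m) ^ (2 * m) = ∏ _i ∈ Finset.range (2 * m), ρ (2 * m) := by
          rw [Finset.prod_const, Finset.card_range]
      _ ≤ ∏ i ∈ Finset.range (2 * m), ρ (2 * m + i) :=
          Finset.prod_le_prod (fun i _ => (hρpos _).le) fun i _ => hρmono (by omega)
  set A := ∏ i ∈ Finset.range m, ρ (m + i) with hAdef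
  set B := ∏ i ∈ Finset.range (2 * m), ρ (2 * m + i) with hBdef
  have hA0 : 0 ≤ A := Finset.prod_nonneg fun i _ => (hρpos _).le
  have h2m : g (2 * m) = g m * A := by rw [two_mul]; exact htel m m
  have h4m : g (4 * m) = g (2 * m) * B := by
    rw [show 4 * m = 2 * m + 2 * m by ring]; exact htel (2 * m) (2 * m)
  have hAB : A ^ 2 ≤ B :=
    calc A ^ 2 ≤ (ρ (2 * m) ^ m) ^ 2 := pow_le_pow_left₀ hA0 hA 2
      _ = ρ (2 * m) ^ (2 * m) := by rw [← pow_mul, mul_comm]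
      _ ≤ B := hB
  have hgm := hpos m
  rw [h4m, h2m]
  calc (g m * A) ^ 3 = g m ^ 2 * (g m * A) * A ^ 2 := by ring
    _ ≤ g m ^ 2 * (g m * A) * B := mul_le_mul_of_nonneg_left hAB (by positivity)
    _ = g m ^ 2 * (g m * A * B) := by ring

/-- `g(2^j) → 0`, from the infrared upper bound `⟨σ₀σ_x⟩_{β_c} ≤ C‖x‖^{-(d-2)}` in `d = 3`
(Duminil-Copin 2019, Thm 4.8; tree `criticalTwoPoint_bounds_holds`). [cite: DuminilCopin2019, Thm. 4.8, §4.4] -/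
private theorem harvest_tendsto_axisG_two_pow : Tendsto (fun j : ℕ => axisG (2 ^ j)) atTop (nhds 0) := by
  obtain ⟨_, C, -, hbound⟩ := criticalTwoPoint_bounds_holds (d := 3) (le_refl 3)
  have hup : ∀ j : ℕ, axisG (2 ^ j) ≤ C * ((2 : ℝ) ^ j)⁻¹ := by
    intro j
    have hx : (Pi.single 0 (((2 ^ j : ℕ) : ℤ)) : Site 3) ≠ 0 := by
      intro h
      have := congrFun h 0
      simp at this
    have h := (hbound _ hx).2
    have hnorm : ‖(Pi.single 0 (((2 ^ j : ℕ) : ℤ)) : Site 3)‖ = (2 : ℝ) ^ j := by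
      rw [Site.norm_eq_supNorm, Site.supNorm_single, Int.natAbs_natCast]; push_cast; rfl
    have he : ((2 : ℝ) ^ j) ^ (-(((3 : ℕ) : ℝ) - 2)) = ((2 : ℝ) ^ j)⁻¹ := by
      rw [Real.rpow_neg (by positivity), show ((3 : ℕ) : ℝ) - 2 = 1 by norm_num, Real.rpow_one]
    rw [hnorm, he] at h
    exact h
  have hlim : Tendsto (fun j : ℕ => C * ((2 : ℝ) ^ j)⁻¹) atTop (nhds 0) := by
    have h := (tendsto_inv_atTop_zero.comp (tendsto_pow_atTop_atTop_of_one_lt one_lt_two)).const_mul C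
    rw [mul_zero] at h
    exact h
  exact tendsto_of_tendsto_of_tendsto_of_le_of_le tendsto_const_nhds hlim
    (fun j => (harvest_axisG_pos _).le) hup

/-! ### The dyadic truncated bubble `B(2^k)` and its shells -/

/-- `B(2^k)` as a sum over the integer cube `box 3 (2^k)`. [folklore] -/
private theorem harvest_Bub_two_pow (k : ℕ) : Bub (2 ^ k) = ∑ x ∈ box 3 (2 ^ k), Gc x ^ 2 := by
  rw [Bub, show ((2 : ℝ) ^ k) = ((2 ^ k : ℕ) : ℝ) by push_cast; rfl, bubbleDiagram_natCast]

/-- The dyadic shell sum: `B(2^{k+1}) - B(2^k) = Σ_{Λ_{2^{k+1}} ∖ Λ_{2^k}} G²`. [folklore] -/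
private theorem harvest_Bub_two_pow_succ_sub (k : ℕ) :
    Bub (2 ^ (k + 1)) - Bub (2 ^ k) = ∑ z ∈ box 3 (2 ^ (k + 1)) \ box 3 (2 ^ k), Gc z ^ 2 := by
  have h := bubbleDiagram_sub_nat (criticalTwoPoint 3) (d := 3) (n := 2 ^ k) (m := 2 ^ (k + 1))
    (Nat.pow_le_pow_right two_pos (Nat.le_succ k))
  push_cast at h
  exact h

/-- Size of the dyadic shell: `#(Λ_{2^{k+1}} ∖ Λ_{2^k}) = (2·2^{k+1}+1)³ - (2·2^k+1)³`
(`|Λ_n| = (2n+1)³`). [folklore] -/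
private theorem harvest_card_shell (k : ℕ) :
    ((#(box 3 (2 ^ (k + 1)) \ box 3 (2 ^ k)) : ℕ) : ℝ) =
      (2 * 2 ^ (k + 1) + 1) ^ 3 - (2 * 2 ^ k + 1) ^ 3 := by
  have h := Finset.card_sdiff_add_card_eq_card
    (box_mono 3 (Nat.pow_le_pow_right two_pos (Nat.le_succ k)))
  rw [card_box, card_box] at h
  have h' : ((#(box 3 (2 ^ (k + 1)) \ box 3 (2 ^ k)) : ℕ) : ℝ) + (2 * 2 ^ k + 1) ^ 3 =
      (2 * 2 ^ (k + 1) + 1) ^ 3 := by exact_mod_cast h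
  linarith

/-- `7·8^{k+1} ≤ #(Λ_{2^{k+1}} ∖ Λ_{2^k})` (with `s = 2^k`: `56s³ ≤ 56s³ + 36s² + 6s`). [folklore] -/
private theorem harvest_seven_mul_le_card_shell (k : ℕ) :
    (7 : ℝ) * 8 ^ (k + 1) ≤ ((#(box 3 (2 ^ (k + 1)) \ box 3 (2 ^ k)) : ℕ) : ℝ) := by
  rw [harvest_card_shell]
  have hs : (1 : ℝ) ≤ 2 ^ k := one_le_pow₀ (by norm_num)
  have e8 : (8 : ℝ) ^ k = ((2 : ℝ) ^ k) ^ 3 := by rw [← pow_mul, mul_comm, pow_mul]; norm_num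
  rw [pow_succ (8 : ℝ) k, pow_succ (2 : ℝ) k, e8]
  nlinarith [hs, sq_nonneg ((2 : ℝ) ^ k)]

/-- `#(Λ_{2^{k+1}} ∖ Λ_{2^k}) ≤ 19·8^{k+1}` (with `s = 2^k ≥ 1`: `56s³ + 36s² + 6s ≤ 152s³`). [folklore] -/
private theorem harvest_card_shell_le (k : ℕ) :
    ((#(box 3 (2 ^ (k + 1)) \ box 3 (2 ^ k)) : ℕ) : ℝ) ≤ (19 : ℝ) * 8 ^ (k + 1) := by
  rw [harvest_card_shell]
  have hs : (1 : ℝ) ≤ 2 ^ k := one_le_pow₀ (by norm_num)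
  have e8 : (8 : ℝ) ^ k = ((2 : ℝ) ^ k) ^ 3 := by rw [← pow_mul, mul_comm, pow_mul]; norm_num
  rw [pow_succ (8 : ℝ) k, pow_succ (2 : ℝ) k, e8]
  nlinarith [hs, sq_nonneg ((2 : ℝ) ^ k), mul_le_mul_of_nonneg_left hs (sq_nonneg ((2 : ℝ) ^ k)),
    mul_le_mul_of_nonneg_left hs (zero_le_one.trans hs)]

/-- On the shell `2^k < ‖z‖_∞ ≤ 2^{k+1}`: `G(z) ≤ g(2^k)` (`G(z) ≤ g(‖z‖_∞)`, Duminil-Copin 2019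
eq. (4.10) from Messager–Miracle-Solé, tree `twoPointPlus_le_axis_of_mem_sphere`; then axis
monotonicity). [cite: AizenmanDuminilCopinAnnals2021, arXiv:1912.07973 §5.1, eq. (5.3) (display after Prop. 5.1)] -/
private theorem harvest_Gc_le_axisG_of_mem_shell {k : ℕ} {z : Site 3}
    (hz : z ∈ box 3 (2 ^ (k + 1)) \ box 3 (2 ^ k)) : Gc z ≤ axisG (2 ^ k) := by
  rw [Finset.mem_sdiff, mem_box_iff_supNorm_le, mem_box_iff_supNorm_le] at hz
  have hMMS : ∀ {β : ℝ}, messager_miracleSole (d := 3) (β := β) := fun {β} =>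
    messager_miracleSole_holds (d := 3) (β := β)
  have h1 := twoPointPlus_le_axis_of_mem_sphere hMMS twoPointPlus_reflection_invariant_holds
    twoPointPlus_perm_invariant_holds (criticalBeta_nonneg 3) (by norm_num : 1 ≤ 3) (self_mem_sphere z)
  have h2 : axisG (Site.supNorm z) ≤ axisG (2 ^ k) := harvest_axisG_le_of_le (by omega)
  exact h1.trans h2

/-- On the shell `‖z‖_∞ ≤ 2^{k+1}`: `g(2^{k+3}) ≤ G(z)` (the Messager–Miracle-Solé comparison in the
sup norm `‖y‖_∞ ≥ 3‖z‖_∞ ⇒ G(y) ≤ G(z)`, Aizenman–Duminil-Copin 2021 (5.3), tree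
`twoPointPlus_le_of_mul_supNorm_le`, as `3·2^{k+1} ≤ 2^{k+3}`). [cite: AizenmanDuminilCopinAnnals2021, arXiv:1912.07973 §5.1, eq. (5.3) (display after Prop. 5.1)] -/
private theorem harvest_axisG_le_Gc_of_mem_shell {k : ℕ} {z : Site 3}
    (hz : z ∈ box 3 (2 ^ (k + 1)) \ box 3 (2 ^ k)) : axisG (2 ^ (k + 3)) ≤ Gc z := by
  rw [Finset.mem_sdiff, mem_box_iff_supNorm_le, mem_box_iff_supNorm_le] at hz
  refine twoPointPlus_le_of_mul_supNorm_le (criticalBeta_nonneg 3) ?_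
  rw [Site.supNorm_single, Int.natAbs_natCast]
  have e : 2 ^ (k + 3) = 4 * 2 ^ (k + 1) := by ring
  omega

/-- Lower shell bound: `7·8^{k+1} g(2^{k+3})² ≤ B(2^{k+1}) - B(2^k)`. [folklore] -/
private theorem harvest_shell_lower_succ (k : ℕ) :
    7 * 8 ^ (k + 1) * axisG (2 ^ (k + 3)) ^ 2 ≤ Bub (2 ^ (k + 1)) - Bub (2 ^ k) := by
  rw [harvest_Bub_two_pow_succ_sub]
  calc 7 * 8 ^ (k + 1) * axisG (2 ^ (k + 3)) ^ 2
      ≤ ((#(box 3 (2 ^ (k + 1)) \ box 3 (2 ^ k)) : ℕ) : ℝ) * axisG (2 ^ (k + 3)) ^ 2 :=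
        mul_le_mul_of_nonneg_right (harvest_seven_mul_le_card_shell k) (sq_nonneg _)
    _ = ∑ _z ∈ box 3 (2 ^ (k + 1)) \ box 3 (2 ^ k), axisG (2 ^ (k + 3)) ^ 2 := by
        rw [Finset.sum_const, nsmul_eq_mul]
    _ ≤ ∑ z ∈ box 3 (2 ^ (k + 1)) \ box 3 (2 ^ k), Gc z ^ 2 :=
        Finset.sum_le_sum fun z hz =>
          pow_le_pow_left₀ (harvest_axisG_pos _).le (harvest_axisG_le_Gc_of_mem_shell hz) 2

/-- Upper shell bound: `B(2^{k+1}) - B(2^k) ≤ 19·8^{k+1} g(2^k)²`. [folklore] -/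
private theorem harvest_shell_upper_succ (k : ℕ) :
    Bub (2 ^ (k + 1)) - Bub (2 ^ k) ≤ 19 * 8 ^ (k + 1) * axisG (2 ^ k) ^ 2 := by
  rw [harvest_Bub_two_pow_succ_sub]
  calc ∑ z ∈ box 3 (2 ^ (k + 1)) \ box 3 (2 ^ k), Gc z ^ 2
      ≤ ∑ _z ∈ box 3 (2 ^ (k + 1)) \ box 3 (2 ^ k), axisG (2 ^ k) ^ 2 :=
        Finset.sum_le_sum fun z hz =>
          pow_le_pow_left₀ (harvest_Gc_pos z).le (harvest_Gc_le_axisG_of_mem_shell hz) 2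
    _ = ((#(box 3 (2 ^ (k + 1)) \ box 3 (2 ^ k)) : ℕ) : ℝ) * axisG (2 ^ k) ^ 2 := by
        rw [Finset.sum_const, nsmul_eq_mul]
    _ ≤ 19 * 8 ^ (k + 1) * axisG (2 ^ k) ^ 2 :=
        mul_le_mul_of_nonneg_right (harvest_card_shell_le k) (sq_nonneg _)

/-- `k ↦ B(2^k)` is non-decreasing (tree `bubbleDiagram_mono`). [folklore] -/
private theorem harvest_Bub_two_pow_mono : Monotone fun k : ℕ => Bub (2 ^ k) := fun _ _ hij =>
  bubbleDiagram_mono _ (pow_le_pow_right₀ one_le_two hij)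

/-- `B(2^k) → ∞`: divergence of the critical bubble `B(β_c(3)) = Σ_x ⟨σ₀σ_x⟩²_{β_c} = ∞`
(Duminil-Copin–Panis 2025, Thm 1.8; tree `DuminilCopinPanis2025_bubbleDiagram_eq_top_holds` for
`⟨·⟩^free = ⟨·⟩⁺` at `β_c`): every finite partial sum of the bubble lies inside some `B(2^k)`. [cite: DuminilCopinPanis2025LowerBounds, Theorem 1.8] -/
private theorem harvest_tendsto_Bub_two_pow : Tendsto (fun k : ℕ => Bub (2 ^ k)) atTop atTop := by
  refine tendsto_atTop_atTop_of_monotone harvest_Bub_two_pow_mono fun M => ?_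
  obtain ⟨s, hs⟩ := DuminilCopinPanis2025_bubbleDiagram_eq_top.exists_finset_sum_gt_three
    DuminilCopinPanis2025_bubbleDiagram_eq_top_holds (M := ENNReal.ofReal M) ENNReal.ofReal_lt_top
  refine ⟨s.sup Site.supNorm, ?_⟩
  have hsub : s ⊆ box 3 (2 ^ s.sup Site.supNorm) := fun x hx =>
    mem_box_iff_supNorm_le.2
      ((Finset.le_sup (f := Site.supNorm) hx).trans (Nat.lt_two_pow_self).le)
  have h1 : ∑ x ∈ s, ENNReal.ofReal (twoPointFree 3 (criticalBeta 3) x) ^ 2 ≤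
      ENNReal.ofReal (Bub (2 ^ s.sup Site.supNorm)) := by
    calc ∑ x ∈ s, ENNReal.ofReal (twoPointFree 3 (criticalBeta 3) x) ^ 2
        ≤ ∑ x ∈ box 3 (2 ^ s.sup Site.supNorm),
            ENNReal.ofReal (twoPointFree 3 (criticalBeta 3) x) ^ 2 :=
          Finset.sum_le_sum_of_subset hsub
      _ = ENNReal.ofReal (Bub (2 ^ s.sup Site.supNorm)) := by
          rw [harvest_Bub_two_pow, ENNReal.ofReal_sum_of_nonneg (fun _ _ => sq_nonneg _)]
          refine Finset.sum_congr rfl fun x _ => ?_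
          rw [ENNReal.ofReal_pow (harvest_Gc_pos x).le, harvest_Gc_eq_twoPointFree]
  have h2 := hs.trans_le h1
  rw [ENNReal.ofReal_lt_ofReal_iff'] at h2
  exact h2.1.le

/-! ### The stub -/

/-- STUB 5a (M) — HARVEST INPUTS: the critical axis profile `a_j = g(2^j) = G(2^j e₁)` and the dyadic
bubble `B_k = B(2^k)` of `G = criticalTwoPoint 3` satisfy `HarvestData`: `a > 0` antitone and `→ 0`
(Messager–Miracle-Solé; infrared bound, Duminil-Copin 2019 Thm 4.8), dyadic log-convexity
`a_{j+1}³ ≤ a_j² a_{j+2}` (axis log-convexity `g(n)² ≤ g(n-1)g(n+1)` from reflection positivity,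
Aizenman–Duminil-Copin 2021 Prop. 5.3, at `m*(β_c(3)) = 0`), `B(1) > 0`, `B` non-decreasing and
`→ ∞` (bubble divergence, Duminil-Copin–Panis 2025 Thm 1.8), and the MMS shell sandwich
`7·8^k a_{k+2}² ≤ B_k - B_{k-1} ≤ 19·8^k a_{k-1}²` for `k ≥ 1` (Aizenman–Duminil-Copin 2021 (5.3)).
All inputs are theorems of the tree (see the module docstring). [cite: AizenmanDuminilCopinAnnals2021, arXiv:1912.07973 §5.1 eq. (5.3), §5.3 Prop. 5.3] -/
theorem stub_harvestInputs : HarvestData (fun j => axisG (2 ^ j)) (fun k => Bub (2 ^ k)) where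
  a_pos j := harvest_axisG_pos (2 ^ j)
  a_anti _ _ hij := harvest_axisG_le_of_le (Nat.pow_le_pow_right two_pos hij)
  a_tendsto := harvest_tendsto_axisG_two_pow
  a_logConvex j := by
    have h := harvest_pow_three_le_of_logConvex harvest_axisG_pos harvest_axisG_succ_sq_le (2 ^ j)
    rwa [← pow_succ', show 4 * 2 ^ j = 2 ^ (j + 2) by ring] at h
  B_pos := by
    show 0 < Bub (2 ^ 0)
    have h0 : criticalTwoPoint 3 0 = 1 := twoPointPlus_zero 3 _
    calc (0 : ℝ) < criticalTwoPoint 3 0 ^ 2 := by rw [h0]; norm_num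
      _ ≤ Bub (2 ^ 0) := sq_apply_zero_le_bubbleDiagram _ (by positivity)
  B_mono := harvest_Bub_two_pow_mono
  B_tendsto := harvest_tendsto_Bub_two_pow
  shell_lower k hk := by
    obtain ⟨k, rfl⟩ : ∃ k', k = k' + 1 := ⟨k - 1, by omega⟩
    rw [show k + 1 + 2 = k + 3 from rfl, Nat.add_sub_cancel]
    exact harvest_shell_lower_succ k
  shell_upper k hk := by
    obtain ⟨k, rfl⟩ : ∃ k', k = k' + 1 := ⟨k - 1, by omega⟩
    rw [Nat.add_sub_cancel]
    exact harvest_shell_upper_succ k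

end Summit.CriticalPhenomena.Ising3DConformalLimit.RungOneAdjacentMergingDominantShell

end
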